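import Literature.NumberTheory.Automorphic.Liu2021.Def411WeilCarriersSurvivalNonsplit
import Literature.NumberTheory.Automorphic.TateLocalZetaShells
import Literature.NumberTheory.Automorphic.AddCharConductorExponent
import Literature.GroupTheory.PiCharacterFactorsFinitely
import HarnessLib

/-!
# The norm-one torus `U(J₁)(F_v) = E_v¹` at a NON-SPLIT place: profinite, characters with open kernel, uniform
# separation from `1`, and the balls of `E_v = Π_{w ∣ v} E_w`

Topic `NumberTheory/Automorphic`; namespace `Literature.NumberTheory.Automorphic.UnitaryGroup` (continuing
`Def411WeilCarriersSurvivalNonsplit` §1: there `U(J₁)(F_v)` is shown integral and COMPACT at a non-split place).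
KERNEL ONLY: theorems, no definition, no named fact, no `sorry`.

For a quadratic extension `E/F` of number fields, `c`, a hermitian LINE `J₁ = (j)` (`j ≠ 0`) and a finite place `v` of
`F` NON-SPLIT in `E` (`c • w = w` for the place `w ∣ v`), the local torus `Z = UnitaryGroup.localPi E c 1 J₁ v ≤ Π_{w∣v}
GL_1(E_w)` (= `E_v¹`, [PlatonovRapinchuk1994, §6.2]) is read through its entry `z ↦ (z_w)₀₀ ∈ E_w`:

* §1 `continuous_entry`, `eq_of_entry_eq` (the entry determines `z`: `w` is the only place above `v`), hence
  `totallyDisconnectedSpace_localPi_one_of_smul_eq` (a continuous injection of the compact `Z` into the totally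
  disconnected `E_w` is an embedding) and **`isOpen_ker_of_smul_eq`**: every continuous character `χ : Z →* ℂˣ` has
  OPEN kernel ([BernsteinZelevinsky1976, §2.1]: characters of a compact totally disconnected group are smooth; tree
  `isOpen_ker_units_complex`); `normAbs_entry_eq_one` (`|z_w|_w = 1`: `Z` is integral, `mem_localInt_one_of_smul_eq`).
* §2 **uniform separation** `exists_forall_sub_one_notMem_primePowBall`: for an open `U ∋ 1` there is `n₀` with
  `z_w - 1 ∉ 𝔭_w^{n₀}` for every `z ∉ U` (compactness of `Z ∖ U`, covered by the open sets `{z_w - 1 ∉ 𝔭_w^n}`).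
* §3 the balls `{e : ∀ w, e_w ∈ 𝔭_w^n}` of `E_v = Π_w E_w` form a basis of neighbourhoods of `0`
  (`exists_forall_mem_primePowBall_subset`), and a compact subgroup modulo an open one is finite
  (`finite_quotient_addSubgroupOf_of_isCompact_of_isOpen`).

Consumer: `RepresentationTheory/MoeglinVignerasWaldspurger1987/RankOneThetaLiftNonvanishingProofs.lean` (free orbit of
`E_v¹` on the characters of an isotropic `E_v`-line).

## References
* [PlatonovRapinchuk1994] V. Platonov, A. Rapinchuk, *Algebraic Groups and Number Theory* (1994), §6.2 (norm tori).
* [BernsteinZelevinsky1976] I. N. Bernstein, A. V. Zelevinsky, Russian Math. Surveys 31 (1976), §2.1.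
* [CasselsFrohlichANT1967] Ch. II §10 (`L ⊗ K_v = Π L_w`), Ch. VII Prop. 1.2 (ii).
-/

set_option autoImplicit false

noncomputable section

open scoped Matrix NNReal Topology
open NumberField IsDedekindDomain Filter Set
open Literature.NumberTheory.Automorphic
open Literature.NumberTheory.GaloisRepresentations.IsNonarchimedeanLocalField

namespace Literature.NumberTheory.Automorphic.UnitaryGroup

variable {F E : Type} [Field F] [NumberField F] [Field E] [NumberField E] [Algebra F E]
variable (c : E ≃ₐ[F] E) (J₁ : Matrix (Fin 1) (Fin 1) E) {v : HeightOneSpectrum (𝓞 F)}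

/-! ## §1 The entry map `z ↦ (z_w)₀₀`, total disconnectedness, open kernels -/

/-- the entry `z ↦ (z_w)₀₀ ∈ E_w` is continuous on `U(J₁)(F_v) ≤ Π_w GL_1(E_w)`. [cite: PlatonovRapinchuk1994, §6.2] -/
theorem continuous_entry (w : PlacesOver E v) :
    Continuous fun z : localPi E c 1 J₁ v =>
      (((z : LocalGLPi E 1 v) w : GL (Fin 1) (w.1.adicCompletion E)) : Matrix (Fin 1) (Fin 1) (w.1.adicCompletion E)) 0 0 :=
  by
  have h1 : Continuous fun z : localPi E c 1 J₁ v => (z : LocalGLPi E 1 v) w :=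
    (continuous_apply w).comp continuous_subtype_val
  have h2 : Continuous fun z : localPi E c 1 J₁ v =>
      (((z : LocalGLPi E 1 v) w : GL (Fin 1) (w.1.adicCompletion E)) : Matrix (Fin 1) (Fin 1) (w.1.adicCompletion E)) :=
    Units.continuous_val.comp h1
  exact h2.matrix_elem 0 0

/-- **at a non-split place the entry determines the element**: `(z_w)₀₀ = (z'_w)₀₀ ⇒ z = z'` (`w` is the only place
above `v`, and the components are `1 × 1` matrices). [cite: CasselsFrohlichANT1967, Ch. VII Prop. 1.2 (ii)] -/
theorem eq_of_entry_eq [Algebra.IsQuadraticExtension F E] (hc : c ≠ 1) (w : PlacesOver E v) (hw : c • w.1 = w.1)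
    {z z' : localPi E c 1 J₁ v}
    (h : (((z : LocalGLPi E 1 v) w : GL (Fin 1) (w.1.adicCompletion E)) : Matrix (Fin 1) (Fin 1) (w.1.adicCompletion E)) 0 0 =
      (((z' : LocalGLPi E 1 v) w : GL (Fin 1) (w.1.adicCompletion E)) : Matrix (Fin 1) (Fin 1) (w.1.adicCompletion E)) 0 0) :
    z = z' := by
  haveI := PlacesOver.subsingleton_of_smul_eq c hc w hw
  refine Subtype.ext (funext fun w' => Units.ext (Matrix.ext fun i j => ?_))
  obtain rfl : w' = w := Subsingleton.elim _ _
  obtain rfl : i = 0 := Subsingleton.elim _ _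
  obtain rfl : j = 0 := Subsingleton.elim _ _
  exact h

/-- **`U(J₁)(F_v)` is totally disconnected** at a non-split place: the entry is a continuous injection of the compact
`U(J₁)(F_v)` into the totally disconnected local field `E_w`, hence an embedding. [cite: PlatonovRapinchuk1994, §6.2] -/
theorem totallyDisconnectedSpace_localPi_one_of_smul_eq [Algebra.IsQuadraticExtension F E] (hc : c ≠ 1)
    (hJ₁ : J₁ 0 0 ≠ 0) (w : PlacesOver E v) (hw : c • w.1 = w.1) :
    TotallyDisconnectedSpace (localPi E c 1 J₁ v) := by
  haveI : CompactSpace (localPi E c 1 J₁ v) := compactSpace_localPi_one_of_smul_eq c J₁ hc hJ₁ w hw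
  have hinj : Function.Injective fun z : localPi E c 1 J₁ v =>
      (((z : LocalGLPi E 1 v) w : GL (Fin 1) (w.1.adicCompletion E)) : Matrix (Fin 1) (Fin 1) (w.1.adicCompletion E)) 0 0 :=
    fun z z' h => eq_of_entry_eq c J₁ hc w hw h
  have hemb := (continuous_entry c J₁ w).isClosedEmbedding hinj
  exact ⟨hemb.isEmbedding.isTotallyDisconnected (isTotallyDisconnected_of_totallyDisconnectedSpace _)⟩

/-- **a continuous character of `U(J₁)(F_v)` has open kernel** at a non-split place (`U(J₁)(F_v)` is compact and
totally disconnected, and `ℂˣ` has no small subgroups). [cite: BernsteinZelevinsky1976, §2.1] -/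
theorem isOpen_ker_of_smul_eq [Algebra.IsQuadraticExtension F E] (hc : c ≠ 1) (hJ₁ : J₁ 0 0 ≠ 0) (w : PlacesOver E v)
    (hw : c • w.1 = w.1) (χ : localPi E c 1 J₁ v →* ℂˣ) (hχc : Continuous fun z => ((χ z : ℂˣ) : ℂ)) :
    IsOpen (χ.ker : Set (localPi E c 1 J₁ v)) := by
  haveI : CompactSpace (localPi E c 1 J₁ v) := compactSpace_localPi_one_of_smul_eq c J₁ hc hJ₁ w hw
  haveI := totallyDisconnectedSpace_localPi_one_of_smul_eq c J₁ hc hJ₁ w hw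
  have hχ : Continuous χ := by
    refine Units.continuous_iff.2 ⟨hχc, ?_⟩
    simp only [Units.val_inv_eq_inv_val]
    exact hχc.inv₀ fun z => (χ z).ne_zero
  exact Literature.GroupTheory.PiCharacter.isOpen_ker_units_complex χ hχ

/-- **`|(z_w)₀₀|_w = 1`**: the entries of the (integral, `mem_localInt_one_of_smul_eq`) torus are units of `𝒪_w`.
[cite: PlatonovRapinchuk1994, §6.2] -/
theorem normAbs_entry_eq_one [Algebra.IsQuadraticExtension F E] (hc : c ≠ 1) (hJ₁ : J₁ 0 0 ≠ 0) (w : PlacesOver E v)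
    (hw : c • w.1 = w.1) (z : localPi E c 1 J₁ v) (w' : PlacesOver E v) :
    normAbs (w'.1.adicCompletion E)
      ((((z : LocalGLPi E 1 v) w' : GL (Fin 1) (w'.1.adicCompletion E)) : Matrix (Fin 1) (Fin 1) (w'.1.adicCompletion E)) 0 0) = 1 := by
  have hint := (mem_localInt_iff E c 1 J₁ v z).1 (mem_localInt_one_of_smul_eq c J₁ hc hJ₁ w hw z) w'
  obtain ⟨h1, h2⟩ := (mem_glInt_iff _).1 hint
  set a : w'.1.adicCompletion E := ((z : LocalGLPi E 1 v) w').val 0 0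
  set b : w'.1.adicCompletion E := (((z : LocalGLPi E 1 v) w')⁻¹).val 0 0
  have ha : normAbs (w'.1.adicCompletion E) a ≤ 1 := normAbs_le_one_iff.2 (h1 0 0)
  have hb : normAbs (w'.1.adicCompletion E) b ≤ 1 := normAbs_le_one_iff.2 (h2 0 0)
  have hba : b * a = 1 := by
    have hmat : (((z : LocalGLPi E 1 v) w')⁻¹).val * ((z : LocalGLPi E 1 v) w').val = 1 := by
      rw [← Units.val_mul, inv_mul_cancel, Units.val_one]
    have h00 := congrFun (congrFun hmat 0) 0
    rw [Matrix.mul_apply, Fin.sum_univ_one, Matrix.one_apply_eq] at h00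
    exact h00
  have hprod : normAbs (w'.1.adicCompletion E) b * normAbs (w'.1.adicCompletion E) a = 1 := by rw [← map_mul, hba, map_one]
  refine le_antisymm ha ?_
  calc (1 : ℝ≥0) = normAbs _ b * normAbs _ a := hprod.symm
    _ ≤ 1 * normAbs _ a := mul_le_mul_of_nonneg_right hb zero_le
    _ = normAbs _ a := one_mul _

/-! ## §2 Uniform separation from `1` off an open neighbourhood -/

/-- **uniform separation**: at a non-split place, for an open `U ∋ 1` in `U(J₁)(F_v)` there is `n₀ ∈ ℤ` such that
`(z_w)₀₀ - 1 ∉ 𝔭_w^{n₀}` for every `z ∉ U` — `Z ∖ U` is compact and `(z_w)₀₀ ≠ 1` on it.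
[cite: PlatonovRapinchuk1994, §6.2] -/
theorem exists_forall_sub_one_notMem_primePowBall [Algebra.IsQuadraticExtension F E] (hc : c ≠ 1) (hJ₁ : J₁ 0 0 ≠ 0)
    (w : PlacesOver E v) (hw : c • w.1 = w.1) {U : Set (localPi E c 1 J₁ v)} (hU : IsOpen U) (h1 : (1 : localPi E c 1 J₁ v) ∈ U) :
    ∃ n₀ : ℤ, ∀ z : localPi E c 1 J₁ v, z ∉ U →
      (((z : LocalGLPi E 1 v) w : GL (Fin 1) (w.1.adicCompletion E)) : Matrix (Fin 1) (Fin 1) (w.1.adicCompletion E)) 0 0 - 1 ∉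
        primePowBall (w.1.adicCompletion E) n₀ := by
  haveI : CompactSpace (localPi E c 1 J₁ v) := compactSpace_localPi_one_of_smul_eq c J₁ hc hJ₁ w hw
  set f : localPi E c 1 J₁ v → w.1.adicCompletion E := fun z =>
    (((z : LocalGLPi E 1 v) w : GL (Fin 1) (w.1.adicCompletion E)) : Matrix (Fin 1) (Fin 1) (w.1.adicCompletion E)) 0 0 - 1
    with hf
  have hfc : Continuous f := (continuous_entry c J₁ w).sub continuous_const
  have hK : IsCompact Uᶜ := hU.isClosed_compl.isCompact
  -- the open cover `W n = {z : f z ∉ 𝔭^n}`, `n : ℕ`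
  have hWo : ∀ n : ℕ, IsOpen {z : localPi E c 1 J₁ v | f z ∉ primePowBall (w.1.adicCompletion E) (n : ℤ)} := fun n =>
    (isClosed_primePowBall (n : ℤ)).isOpen_compl.preimage hfc
  have hcover : Uᶜ ⊆ ⋃ n : ℕ, {z : localPi E c 1 J₁ v | f z ∉ primePowBall (w.1.adicCompletion E) (n : ℤ)} := by
    intro z hz
    have hfz : f z ≠ 0 := by
      intro h0
      apply hz
      have : z = 1 := eq_of_entry_eq c J₁ hc w hw (z' := 1) (by
        rw [hf] at h0
        have h0' := sub_eq_zero.1 h0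
        rw [h0']
        simp [Units.val_one, Matrix.one_apply_eq])
      rw [this]; exact h1
    obtain ⟨k, hk⟩ := exists_normAbs_eq_inv_zpow hfz
    refine Set.mem_iUnion.2 ⟨(k + 1).toNat, ?_⟩
    simp only [Set.mem_setOf_eq, mem_primePowBall_iff, hk, not_le]
    exact zpow_lt_zpow_right_of_lt_one₀ inv_residueFieldCard_pos inv_residueFieldCard_lt_one
      (by have := Int.self_le_toNat (k + 1); omega)
  have hdir : Directed (· ⊆ ·) fun n : ℕ => {z : localPi E c 1 J₁ v | f z ∉ primePowBall (w.1.adicCompletion E) (n : ℤ)} :=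
    Monotone.directed_le fun a b hab z hz hz' => hz (primePowBall_antitone (by exact_mod_cast hab) hz')
  obtain ⟨n, hn⟩ := hK.elim_directed_cover _ hWo hcover hdir
  exact ⟨n, fun z hz => hn (Set.mem_compl hz)⟩

/-! ## §3 Balls of `E_v = Π_{w ∣ v} E_w` -/

/-- **the boxes `Π_w 𝔭_w^n` are a basis of neighbourhoods of `0` in `E_v = Π_{w∣v} E_w`.** [cite: CasselsFrohlichANT1967, Ch. II §10–§11] -/
theorem exists_forall_mem_primePowBall_subset {O : Set (LocalRing E v)} (hO : O ∈ 𝓝 (0 : LocalRing E v)) :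
    ∃ n : ℤ, ∀ e : LocalRing E v, (∀ w : PlacesOver E v, e w ∈ primePowBall (w.1.adicCompletion E) n) → e ∈ O := by
  classical
  rw [nhds_pi, Filter.mem_pi] at hO
  obtain ⟨I, -, t, ht, htO⟩ := hO
  have hn : ∀ w : PlacesOver E v, ∃ n : ℕ, primePowBall (w.1.adicCompletion E) (n : ℤ) ⊆ t w := fun w =>
    exists_primePowBall_subset_of_mem_nhds_zero (ht w)
  choose n hn using hn
  refine ⟨(Finset.univ.sup n : ℕ), fun e he => htO fun w _ => hn w (primePowBall_antitone ?_ (he w))⟩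
  exact_mod_cast Finset.le_sup (Finset.mem_univ w)

omit [NumberField F] [NumberField E] in
/-- in a topological additive group, a compact subgroup modulo an open subgroup is finite. [cite: BernsteinZelevinsky1976, §2.1] -/
theorem finite_quotient_addSubgroupOf_of_isCompact_of_isOpen {X : Type*} [AddCommGroup X] [TopologicalSpace X]
    [IsTopologicalAddGroup X] (C₀ C : AddSubgroup X) (hC : IsCompact (C : Set X)) (hC₀ : IsOpen (C₀ : Set X)) :
    Finite (C ⧸ C₀.addSubgroupOf C) := by
  haveI : CompactSpace C := isCompact_iff_compactSpace.1 hC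
  exact AddSubgroup.quotient_finite_of_isOpen _ (hC₀.preimage continuous_subtype_val)

end Literature.NumberTheory.Automorphic.UnitaryGroup

end
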